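import Summits.BirchSwinnertonDyer.BirchSwinnertonDyer.Theorems.PrintCFramBottomClassIndexLawFiveLeBorelH1Vanishing
import HarnessLib

/-!
# Route `PrintCFram`, crux C2 `BottomClassIndexLawFiveLe` (stmt-BirchSwinnertonDyer-20372), line
# `eisenstein-resource-bdp-line` (S2 `stub_kolyvaginUpper_borelCM`, device (γ) «𝓞_𝔭-linearisation»):
# `E[p^M]` IS FREE OF RANK ONE OVER `𝓞_K/p^M = (ℤ/p^M)[√−p]` AT THE RAMIFIED PRIME, for every CM curve
# `W/ℚ` with `p ≥ 5` ramified in the CM field and every `M ≥ 1`; hence the commutant of `√−p` on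
# `E[p^M]` is `ℤ/p^M + ℤ/p^M·√−p` and `Gal(K(E[p^M])/K)` is ABELIAN (Rubin 1999 Prop. 5.4 / Cor. 5.5
# at the ramified prime — the case the tree's `ComplexMultiplicationShaRubin*` files leave open)
# (cell `bsd-print-cfram`, seat `bsd-line-cfram-p1-w2` g5; helper `--supports` 20372; 0 facts, 0 defs)

HONEST FRAMING. Nothing about BSD is proved here. GENERIC §1: an abelian group `A` with an additive
`μ`, `μ ∘ μ = [m]`, `|m| = p` prime, `#A[p] = p²`, `#A[p^M] = p^{2M}` and `μ ≠ 0` on `A[p]`; then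
`#ker μ = p` (`natCard_ker_eq`), `A[p^M] = ℤv + ℤμv` for some `v` (`exists_generator_pair`: `A[p^M]/μA[p^M]`
has prime order, then Nakayama along `μ² = ±p`), and every additive endomorphism of `A` commuting with
`μ` is `a + bμ` on `A[p^M]` (`exists_eq_smul_add_smul_of_comm`). §2 on the leaf (`W.HasCM`,
`CMRamified W p`, `5 ≤ p`; `μ = √−p` of `BorelHomothety.exists_sqrt_end_of_cmRamified`):
**`exists_generator_pair_of_cmRamified`** (`W[p^M] = ℤv + ℤ·μv`), **`smul_eq_smul_add_smul_of_cmRamified`**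
(every `g ∈ Γ_ℚ` fixing `√−p` acts on `W[p^M]` as `a + bμ`), **`smul_comm_of_cmRamified`** (two such
elements commute on `W[p^M]`), and over a number field `K ∋ √−p` (the CM field):
**`exists_mem_torsionFixing_mul_eq_of_cmRamified`** — `Γ_K` acts on `E_K[p^M]` through an ABELIAN
quotient (the input `hab` of `Rubin1987.subgroupResKer_torsionFixing_eq_bot`, at the ramified `p`).
THEOREMS ONLY; no definition, no named fact, no `sorry`; imports no `Theses` module. BSD is not proved
by any of this; no summit statement is proved by this seat.
References: [Rubin1999] Prop. 5.4, Cor. 5.5, Cor. 5.20; [SilvermanAdvancedTopics1994] II.2.3.1.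
-/

set_option autoImplicit false
-- `…BirchSwinnertonDyer.BirchSwinnertonDyer.Theorems…` is the problem's mandated namespace (D-0017).
set_option linter.dupNamespace false

noncomputable section

open scoped Classical

namespace Summit.BirchSwinnertonDyer.BirchSwinnertonDyer.Theorems.PrintCFram.BorelHomothety

open WeierstrassCurve Field Literature.NumberTheory.EllipticCurves
  Literature.NumberTheory.GaloisRepresentations Literature.NumberTheory.EllipticCurves.Rank1Residual

universe u

/-! ## §1 Generic: an abelian group with `μ ∘ μ = [m]`, `|m| = p` -/

section Generic

variable {A : Type*} [AddCommGroup A] (μ : A →+ A) {m : ℤ} {p : ℕ}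

/-- `ker μ ⊆ A[p]`: `μ μ P = m P = 0` and `|m| = p`. [folklore] -/
theorem ker_le_torsionBy (hμμ : ∀ P, μ (μ P) = m • P) (hm : m.natAbs = p) :
    μ.ker ≤ AddSubgroup.torsionBy A (p : ℤ) := by
  intro P hP
  rw [AddMonoidHom.mem_ker] at hP
  refine AddSubgroup.torsionBy.nsmul_iff.mpr ?_
  rw [← hm]
  exact natAbs_nsmul_eq_zero.mpr (by rw [← hμμ, hP, map_zero])

/-- `μ` maps `A[n]` into `A[n]`. [folklore] -/
theorem apply_mem_torsionBy {n : ℕ} {P : A} (hP : P ∈ AddSubgroup.torsionBy A (n : ℤ)) :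
    μ P ∈ AddSubgroup.torsionBy A (n : ℤ) := by
  rw [AddSubgroup.torsionBy.nsmul_iff, ← map_nsmul, AddSubgroup.torsionBy.nsmul_iff.mp hP, map_zero]

/-- **`#ker μ = p`.** `μ(A[p]) ⊆ ker μ ⊆ A[p]`, so `p² = #A[p] = #ker μ · #μ(A[p]) ≤ (#ker μ)²`, while
`ker μ ≠ A[p]` (`μ ≠ 0` on `A[p]`) and `#ker μ ∣ p²`. [folklore] -/
theorem natCard_ker_eq (hμμ : ∀ P, μ (μ P) = m • P) (hm : m.natAbs = p) (hp : p.Prime)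
    (hcard : Nat.card (AddSubgroup.torsionBy A (p : ℤ)) = p ^ 2)
    (hne : ∃ P ∈ AddSubgroup.torsionBy A (p : ℤ), μ P ≠ 0) : Nat.card μ.ker = p := by
  haveI : Finite (AddSubgroup.torsionBy A (p : ℤ)) :=
    Nat.finite_of_card_ne_zero (by rw [hcard]; exact pow_ne_zero 2 hp.ne_zero)
  have hle := ker_le_torsionBy μ hμμ hm
  -- `μ` restricted to `A[p]`, with values in `A[p]`
  set μ₁ : AddSubgroup.torsionBy A (p : ℤ) →+ AddSubgroup.torsionBy A (p : ℤ) :=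
    { toFun := fun P => ⟨μ P, apply_mem_torsionBy μ P.2⟩
      map_zero' := Subtype.ext (by simp)
      map_add' := fun P Q => Subtype.ext (by simp) } with hμ₁
  -- `ker μ₁ ≃ ker μ` and `range μ₁ ↪ ker μ`
  have hker : Nat.card μ₁.ker = Nat.card μ.ker := Nat.card_congr
    { toFun := fun P => ⟨(P.1 : A), by
        have h := P.2; rw [AddMonoidHom.mem_ker] at h ⊢; exact congrArg Subtype.val h⟩
      invFun := fun Q => ⟨⟨Q.1, hle Q.2⟩, by
        rw [AddMonoidHom.mem_ker]; exact Subtype.ext (by exact (AddMonoidHom.mem_ker).mp Q.2)⟩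
      left_inv := fun P => rfl
      right_inv := fun Q => rfl }
  have hrange : Nat.card μ₁.range ≤ Nat.card μ.ker := by
    haveI : Finite μ.ker := Finite.of_injective (fun Q : μ.ker => (⟨Q.1, hle Q.2⟩ :
      AddSubgroup.torsionBy A (p : ℤ))) (fun Q Q' h => by
        apply Subtype.ext
        have h' := congrArg Subtype.val h
        exact h')
    refine Nat.card_le_card_of_injective (fun R => ⟨(R.1 : A), ?_⟩) ?_
    · obtain ⟨Q, hQ⟩ := R.2
      rw [AddMonoidHom.mem_ker, ← hQ]
      change μ (μ Q) = 0
      rw [hμμ, ← natAbs_nsmul_eq_zero, hm]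
      exact AddSubgroup.torsionBy.nsmul_iff.mp Q.2
    · intro R R' h
      apply Subtype.ext
      apply Subtype.ext
      have h' := congrArg Subtype.val h
      exact h'
  -- counting
  have h1 : Nat.card (AddSubgroup.torsionBy A (p : ℤ) ⧸ μ₁.ker) = Nat.card μ₁.range :=
    Nat.card_congr (QuotientAddGroup.quotientKerEquivRange μ₁).toEquiv
  have h2 := μ₁.ker.card_eq_card_quotient_mul_card_addSubgroup
  rw [hcard, h1, hker] at h2
  have hdvd : Nat.card μ.ker ∣ p ^ 2 := by rw [← hcard, ← hker]; exact μ₁.ker.card_addSubgroup_dvd_card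
  obtain ⟨i, hi, hci⟩ := (Nat.dvd_prime_pow hp).mp hdvd
  interval_cases i
  · -- `#ker = 1`: then `p² ≤ 1`
    exfalso
    rw [hci, pow_zero] at hrange h2
    have : p ^ 2 ≤ 1 := by rw [h2]; simpa using hrange
    nlinarith [hp.two_le]
  · rw [hci, pow_one]
  · -- `#ker = p²`: `ker μ = A[p]`, contradicting `hne`
    exfalso
    obtain ⟨P, hP, hP0⟩ := hne
    have heq : μ₁.ker = ⊤ := AddSubgroup.eq_top_of_card_eq _ (by rw [hker, hci, hcard])
    have hmem : (⟨P, hP⟩ : AddSubgroup.torsionBy A (p : ℤ)) ∈ μ₁.ker := by rw [heq]; exact AddSubgroup.mem_top _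
    rw [AddMonoidHom.mem_ker] at hmem
    exact hP0 (congrArg Subtype.val hmem)

/-- **`A[p^M] = ℤv + ℤμv`** (`E[p^M]` is cyclic over `(ℤ/p^M)[μ]`): the quotient `A[p^M]/μA[p^M]` has
prime order `p` (`#ker μ = p`), so `A[p^M] = ℤv + μA[p^M]` for any `v ∉ μA[p^M]`, and iterating with
`μ² = [m]`, `m^M A[p^M] = 0`: `A[p^M] = ℤv + ℤμv`. [cite: Rubin1999, Prop. 5.4 (E[𝔭ⁿ] ≅ 𝒪/𝔭ⁿ)] -/
theorem exists_generator_pair (hμμ : ∀ P, μ (μ P) = m • P) (hm : m.natAbs = p) (hp : p.Prime)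
    (hcard : Nat.card (AddSubgroup.torsionBy A (p : ℤ)) = p ^ 2)
    (hne : ∃ P ∈ AddSubgroup.torsionBy A (p : ℤ), μ P ≠ 0) {M : ℕ} (hM : 1 ≤ M)
    (hcardM : Nat.card (AddSubgroup.torsionBy A ((p ^ M : ℕ) : ℤ)) = p ^ (2 * M)) :
    ∃ v ∈ AddSubgroup.torsionBy A ((p ^ M : ℕ) : ℤ),
      ∀ P ∈ AddSubgroup.torsionBy A ((p ^ M : ℕ) : ℤ), ∃ a b : ℤ, P = a • v + b • μ v := by
  set T := AddSubgroup.torsionBy A ((p ^ M : ℕ) : ℤ) with hT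
  haveI : Finite T := Nat.finite_of_card_ne_zero (by rw [hcardM]; exact pow_ne_zero _ hp.ne_zero)
  -- `A[p] ≤ T` and `ker μ ≤ T`
  have hpT : AddSubgroup.torsionBy A (p : ℤ) ≤ T := by
    intro P hP
    refine AddSubgroup.torsionBy.nsmul_iff.mpr ?_
    obtain ⟨k, hk⟩ : ∃ k, M = k + 1 := ⟨M - 1, by omega⟩
    rw [hk, pow_succ, mul_nsmul', AddSubgroup.torsionBy.nsmul_iff.mp hP, nsmul_zero]
  have hkerT : μ.ker ≤ T := (ker_le_torsionBy μ hμμ hm).trans hpT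
  -- `μ` on `T`
  set μT : T →+ T :=
    { toFun := fun P => ⟨μ P, apply_mem_torsionBy μ P.2⟩
      map_zero' := Subtype.ext (by simp)
      map_add' := fun P Q => Subtype.ext (by simp) } with hμT_def
  have hμT : ∀ P : T, ((μT P : T) : A) = μ P := fun P => rfl
  -- `#ker μT = p`, `#range μT · p = #T`, `#(T / range) = p`
  have hker : Nat.card μT.ker = p := by
    rw [← natCard_ker_eq μ hμμ hm hp hcard hne]
    exact Nat.card_congr
      { toFun := fun P => ⟨(P.1 : A), by
          have h := P.2; rw [AddMonoidHom.mem_ker] at h ⊢; exact congrArg Subtype.val h⟩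
        invFun := fun Q => ⟨⟨Q.1, hkerT Q.2⟩, by
          rw [AddMonoidHom.mem_ker]; exact Subtype.ext (by exact (AddMonoidHom.mem_ker).mp Q.2)⟩
        left_inv := fun P => rfl
        right_inv := fun Q => rfl }
  set R : AddSubgroup T := μT.range with hR_def
  have hRcard : Nat.card R * p = Nat.card T := by
    have h1 : Nat.card (T ⧸ μT.ker) = Nat.card R :=
      Nat.card_congr (QuotientAddGroup.quotientKerEquivRange μT).toEquiv
    have h2 := μT.ker.card_eq_card_quotient_mul_card_addSubgroup
    rw [h1, hker] at h2
    exact h2.symm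
  have hQcard : Nat.card (T ⧸ R) = p := by
    have h2 := R.card_eq_card_quotient_mul_card_addSubgroup
    have hR0 : Nat.card R ≠ 0 := Nat.card_pos.ne'
    have h3 : Nat.card (T ⧸ R) * Nat.card R = p * Nat.card R := by rw [← h2, ← hRcard, mul_comm]
    exact Nat.eq_of_mul_eq_mul_right (Nat.pos_of_ne_zero hR0) h3
  -- a vector outside `μT(T)`
  have hidx : R.index = p := by rw [AddSubgroup.index_eq_card]; exact hQcard
  obtain ⟨v, hv⟩ : ∃ v : T, v ∉ R := by
    by_contra h
    simp only [not_exists, not_not] at h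
    have htop : R = ⊤ := (AddSubgroup.eq_top_iff' R).mpr h
    rw [htop, AddSubgroup.index_top] at hidx
    exact hp.one_lt.ne' hidx.symm
  have hv0 : (QuotientAddGroup.mk v : T ⧸ R) ≠ 0 := fun h0 => hv ((QuotientAddGroup.eq_zero_iff v).mp h0)
  have htop : (⊤ : AddSubgroup (T ⧸ R)) = AddSubgroup.zmultiples (QuotientAddGroup.mk v) :=
    PrintCFram.LineCharacter.eq_zmultiples_of_card_eq_prime hp (by rw [AddSubgroup.card_top, hQcard])
      (AddSubgroup.mem_top _) hv0
  -- `T = ℤv + μT(T)`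
  have hstep : ∀ P : T, ∃ (a : ℤ) (P₁ : T), P = a • v + μT P₁ := by
    intro P
    obtain ⟨a, ha⟩ : ∃ a : ℤ, a • (QuotientAddGroup.mk v : T ⧸ R) = QuotientAddGroup.mk P := by
      have h := AddSubgroup.mem_top (QuotientAddGroup.mk P : T ⧸ R)
      rw [htop, AddSubgroup.mem_zmultiples_iff] at h
      exact h
    have hmem : P - a • v ∈ R := by
      rw [← QuotientAddGroup.eq_zero_iff, QuotientAddGroup.mk_sub, QuotientAddGroup.mk_zsmul, ← ha, sub_self]
    obtain ⟨P₁, hP₁⟩ := hmem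
    exact ⟨a, P₁, by rw [hP₁]; abel⟩
  -- Nakayama along `μ² = m`
  have hμμT : ∀ P : T, μT (μT P) = m • P := fun P => Subtype.ext (by
    change μ (μ (P : A)) = ((m • P : T) : A)
    rw [hμμ]; rfl)
  have hiter : ∀ k : ℕ, ∀ P : T, ∃ (a b : ℤ) (P' : T), P = a • v + b • μT v + (m ^ k) • P' := by
    intro k
    induction k with
    | zero => exact fun P => ⟨0, 0, P, by simp⟩
    | succ k ih =>
      intro P
      obtain ⟨a, b, P', hP⟩ := ih P
      obtain ⟨a', P₁, hP'⟩ := hstep P'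
      obtain ⟨a₁, P₂, hP₁⟩ := hstep P₁
      refine ⟨a + m ^ k * a', b + m ^ k * a₁, P₂, ?_⟩
      rw [hP, hP', hP₁, map_add, map_zsmul, hμμT, pow_succ]
      module
  refine ⟨(v : A), v.2, fun P hP => ?_⟩
  obtain ⟨a, b, P', h⟩ := hiter M ⟨P, hP⟩
  have hkill : (m ^ M) • P' = 0 := by
    rw [← natAbs_nsmul_eq_zero, Int.natAbs_pow, hm]
    exact AddSubgroup.torsionBy.nsmul P'
  rw [hkill, add_zero] at h
  exact ⟨a, b, by simpa [hμT] using congrArg Subtype.val h⟩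

/-- **The commutant of `μ` on `A[p^M]` is `ℤ/p^M + ℤ/p^M·μ`**: an additive endomorphism `f` of `A`
commuting with `μ` acts on `A[p^M] = ℤv + ℤμv` as `a + bμ`, where `f v = a v + b μv`.
[cite: Rubin1999, Cor. 5.5 (the action commutes with 𝒪 and E[𝔭ⁿ] is cyclic)] -/
theorem exists_eq_smul_add_smul_of_comm (hμμ : ∀ P, μ (μ P) = m • P) (hm : m.natAbs = p)
    (hp : p.Prime) (hcard : Nat.card (AddSubgroup.torsionBy A (p : ℤ)) = p ^ 2)
    (hne : ∃ P ∈ AddSubgroup.torsionBy A (p : ℤ), μ P ≠ 0) {M : ℕ} (hM : 1 ≤ M)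
    (hcardM : Nat.card (AddSubgroup.torsionBy A ((p ^ M : ℕ) : ℤ)) = p ^ (2 * M))
    (f : A →+ A) (hf : ∀ P, f (μ P) = μ (f P))
    (hfT : ∀ P ∈ AddSubgroup.torsionBy A ((p ^ M : ℕ) : ℤ), f P ∈ AddSubgroup.torsionBy A ((p ^ M : ℕ) : ℤ)) :
    ∃ a b : ℤ, ∀ P ∈ AddSubgroup.torsionBy A ((p ^ M : ℕ) : ℤ), f P = a • P + b • μ P := by
  obtain ⟨v, hv, hgen⟩ := exists_generator_pair μ hμμ hm hp hcard hne hM hcardM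
  obtain ⟨a, b, hab⟩ := hgen (f v) (hfT v hv)
  refine ⟨a, b, fun P hP => ?_⟩
  obtain ⟨a', b', rfl⟩ := hgen P hP
  rw [map_add, map_zsmul, map_zsmul, hf, hab, map_add, map_zsmul, map_zsmul, hμμ]
  simp only [smul_add, smul_smul, map_add, map_zsmul, hμμ]
  module

end Generic

/-! ## §2 On the leaf: `W[p^M] = ℤv + ℤ·√−p v`, the commutant, and the abelian image of `Γ_{ℚ(√−p)}` -/

section Leaf

variable (W : WeierstrassCurve ℚ) [W.IsElliptic] (p : ℕ) [hp : Fact p.Prime]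

/-- `#W[p^M] = p^{2M}`. [cite: SilvermanAEC2009, Cor. III.6.4(b)] -/
theorem natCard_geomTorsion_pow (M : ℕ) :
    Nat.card (W.geomTorsion ((p ^ M : ℕ) : ℤ)) = p ^ (2 * M) := by
  have h0 : ((p ^ M : ℕ) : AlgebraicClosure ℚ) ≠ 0 := by
    exact_mod_cast pow_ne_zero M hp.out.ne_zero
  have h : Nat.card (W.geomTorsion ((p ^ M : ℕ) : ℤ)) = (p ^ M) ^ 2 :=
    card_torsionPoints_eq_sq_holds W (AlgebraicClosure ℚ) (n := p ^ M) h0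
  rw [h, ← pow_mul, mul_comm]

/-- **`W[p^M]` is free of rank one over `(ℤ/p^M)[√−p]` on the leaf.** For `W/ℚ` with CM and `p ≥ 5`
ramified in the CM field: `s = √−p ∈ ℚ̄` and `μ ∈ End W(ℚ̄)` with `μ ∘ μ = [m]`, `|m| = p`, the Galois
sign rule, and for every `M ≥ 1` a generator `v`: `W[p^M] = ℤv + ℤ·μv`.
[cite: Rubin1999, Prop. 5.4 (E[𝔭ⁿ] ≅ 𝒪/𝔭ⁿ)] [cite: SilvermanATAEC1994, App. A §3] -/
theorem exists_generator_pair_of_cmRamified (hCM : W.HasCM) (h5 : 5 ≤ p) (hram : CMRamified W p) :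
    ∃ (s : AlgebraicClosure ℚ) (μ : AddMonoid.End W.geomPoints) (m : ℤ),
      s ^ 2 = ((-(p : ℤ) : ℤ) : AlgebraicClosure ℚ) ∧ m.natAbs = p ∧ (∀ P, μ (μ P) = m • P) ∧
      (∀ g : absoluteGaloisGroup ℚ, g • s = s → ∀ P, μ (g • P) = g • μ P) ∧
      (∀ g : absoluteGaloisGroup ℚ, g • s = -s → ∀ P, μ (g • P) = -(g • μ P)) ∧
      (∃ P ∈ W.geomTorsion (p : ℤ), μ P ≠ 0) ∧
      ∀ {M : ℕ}, 1 ≤ M → ∃ v ∈ W.geomTorsion ((p ^ M : ℕ) : ℤ),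
        ∀ P ∈ W.geomTorsion ((p ^ M : ℕ) : ℤ), ∃ a b : ℤ, P = a • v + b • μ v := by
  obtain ⟨s, μ, m, hs, hm, hμμ, hcomm, hanti⟩ := exists_sqrt_end_of_cmRamified W p hCM h5 hram
  have hne := exists_mem_geomTorsion_apply_ne_zero W p hμμ hm
  refine ⟨s, μ, m, hs, hm, hμμ, hcomm, hanti, hne, fun {M} hM => ?_⟩
  exact exists_generator_pair (μ : W.geomPoints →+ W.geomPoints) hμμ hm hp.out
    (W.natCard_geomTorsion_prime_eq_sq hp.out) hne hM (natCard_geomTorsion_pow W p M)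

/-- **Every `g ∈ Γ_ℚ` fixing `√−p` acts on `W[p^M]` as `a + b·√−p`** (the image of `Γ_{ℚ(√−p)}` in
`Aut W[p^M]` lies in `((ℤ/p^M)[√−p])ˣ`), for `μ = √−p` as in `exists_generator_pair_of_cmRamified`.
[cite: Rubin1999, Cor. 5.5 and Cor. 5.20] -/
theorem smul_eq_smul_add_smul_of_comm {μ : AddMonoid.End W.geomPoints} {m : ℤ}
    (hμμ : ∀ P, μ (μ P) = m • P) (hm : m.natAbs = p) (hne : ∃ P ∈ W.geomTorsion (p : ℤ), μ P ≠ 0)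
    {M : ℕ} (hM : 1 ≤ M) {g : absoluteGaloisGroup ℚ} (hg : ∀ P, μ (g • P) = g • μ P) :
    ∃ a b : ℤ, ∀ P ∈ W.geomTorsion ((p ^ M : ℕ) : ℤ), g • P = a • P + b • μ P := by
  have h := exists_eq_smul_add_smul_of_comm (μ : W.geomPoints →+ W.geomPoints) hμμ hm hp.out
    (W.natCard_geomTorsion_prime_eq_sq hp.out) hne hM (natCard_geomTorsion_pow W p M)
    (DistribSMul.toAddMonoidHom W.geomPoints g) (fun P => (hg P).symm)
    (fun P hP => Literature.NumberTheory.EllipticCurves.smul_mem_torsionBy g hP)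
  obtain ⟨a, b, hab⟩ := h
  exact ⟨a, b, fun P hP => hab P hP⟩

/-- **Two elements of `Γ_ℚ` commuting with `√−p` commute on `W[p^M]`** (the image of `Γ_{ℚ(√−p)}`
on `W[p^M]` is ABELIAN), on the leaf. [cite: Rubin1999, Cor. 5.5 (Gal(K(E[𝔭ⁿ])/K) ↪ (𝒪/𝔭ⁿ)ˣ)] -/
theorem smul_comm_of_comm {μ : AddMonoid.End W.geomPoints} {m : ℤ}
    (hμμ : ∀ P, μ (μ P) = m • P) (hm : m.natAbs = p) (hne : ∃ P ∈ W.geomTorsion (p : ℤ), μ P ≠ 0)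
    {M : ℕ} (hM : 1 ≤ M) {g h : absoluteGaloisGroup ℚ} (hg : ∀ P, μ (g • P) = g • μ P)
    (hh : ∀ P, μ (h • P) = h • μ P) :
    ∀ P ∈ W.geomTorsion ((p ^ M : ℕ) : ℤ), g • h • P = h • g • P := by
  obtain ⟨a, b, hab⟩ := smul_eq_smul_add_smul_of_comm W p hμμ hm hne hM hg
  obtain ⟨c, d, hcd⟩ := smul_eq_smul_add_smul_of_comm W p hμμ hm hne hM hh
  intro P hP
  have hμP : μ P ∈ W.geomTorsion ((p ^ M : ℕ) : ℤ) :=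
    apply_mem_torsionBy (μ : W.geomPoints →+ W.geomPoints) hP
  have hgP : g • P ∈ W.geomTorsion ((p ^ M : ℕ) : ℤ) :=
    Literature.NumberTheory.EllipticCurves.smul_mem_torsionBy g hP
  have hhP : h • P ∈ W.geomTorsion ((p ^ M : ℕ) : ℤ) :=
    Literature.NumberTheory.EllipticCurves.smul_mem_torsionBy h hP
  have hL : g • h • P = c • (a • P + b • μ P) + d • μ (a • P + b • μ P) := by
    rw [hcd P hP, smul_add, smul_comm g c P, smul_comm g d (μ P), ← hg P, hab P hP]
  have hR : h • g • P = a • (c • P + d • μ P) + b • μ (c • P + d • μ P) := by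
    rw [hab P hP, smul_add, smul_comm h a P, smul_comm h b (μ P), ← hh P, hcd P hP]
  rw [hL, hR]
  simp only [map_add, map_zsmul, hμμ, smul_add, smul_smul]
  module

/-- **`Γ_K` acts on `E_K[p^M]` through an ABELIAN quotient** for every number field `K ∋ √−p` (e.g.
the CM field `ℚ(√−p)`), on the leaf: for `a, b ∈ Γ_K` there is `t ∈ Γ_{K(E[p^M])}` with
`a b = b a t` — the input `hab` of `Rubin1987.subgroupResKer_torsionFixing_eq_bot` (Rubin 1999
Lemma 6.2 (i) / Cor. 5.20) at the RAMIFIED prime, which the tree's `ComplexMultiplicationShaRubin*`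
files supply only at inert primes. [cite: Rubin1999, Cor. 5.20 and Lemma 6.2 (i)] -/
theorem exists_mem_torsionFixing_mul_eq_of_cmRamified (hCM : W.HasCM) (h5 : 5 ≤ p)
    (hram : CMRamified W p) (K : Type) [Field K] [NumberField K] (hK : ∃ y : K, y ^ 2 = -(p : K))
    {M : ℕ} (hM : 1 ≤ M) (a b : absoluteGaloisGroup K) :
    ∃ t ∈ torsionFixing (W.baseChange K) ((p ^ M : ℕ) : ℤ), a * b = b * a * t := by
  obtain ⟨s, μ, m, hs, hm, hμμ, hcomm, -, hne, -⟩ := exists_generator_pair_of_cmRamified W p hCM h5 hram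
  -- every `res σ`, `σ ∈ Γ_K`, fixes `s` (as `√−p ∈ K`)
  have hfix : ∀ σ : absoluteGaloisGroup K, absGaloisRestrict ℚ K σ • s = s := by
    intro σ
    obtain ⟨y, hy⟩ := hK
    have hs' : (absClosureEmbedding ℚ K s) ^ 2 = algebraMap K (AlgebraicClosure K) (-(p : K)) :=
      absClosureEmbedding_sq p K hs
    have hy' : (algebraMap K (AlgebraicClosure K) y) ^ 2 = algebraMap K (AlgebraicClosure K) (-(p : K)) := by
      rw [← map_pow, hy]
    have hpm : absClosureEmbedding ℚ K s = algebraMap K _ y ∨ absClosureEmbedding ℚ K s = -algebraMap K _ y := by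
      have h' : (absClosureEmbedding ℚ K s - algebraMap K _ y) * (absClosureEmbedding ℚ K s + algebraMap K _ y) = 0 := by
        linear_combination hs' - hy'
      rcases mul_eq_zero.mp h' with h0 | h0
      · exact Or.inl (sub_eq_zero.mp h0)
      · exact Or.inr (add_eq_zero_iff_eq_neg.mp h0)
    refine (absClosureEmbedding ℚ K).injective ?_
    show absClosureEmbedding ℚ K (absGaloisRestrict ℚ K σ • s) = absClosureEmbedding ℚ K s
    rw [absGaloisRestrict_apply_smul]
    rcases hpm with h0 | h0
    · rw [h0, smul_algebraMap]
    · rw [h0, smul_neg, smul_algebraMap]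
  refine ⟨(b * a)⁻¹ * (a * b), (mem_torsionFixing_iff (W.baseChange K) _).mpr fun Q => ?_, by group⟩
  obtain ⟨P, rfl⟩ := (RatClosure.torsionEquiv (K := K) W ((p ^ M : ℕ) : ℤ)).surjective Q
  have hcommP : (absGaloisRestrict ℚ K a * absGaloisRestrict ℚ K b) • P =
      (absGaloisRestrict ℚ K b * absGaloisRestrict ℚ K a) • P := by
    refine Subtype.ext ?_
    change (absGaloisRestrict ℚ K a * absGaloisRestrict ℚ K b) • (P : W.geomPoints) =
      (absGaloisRestrict ℚ K b * absGaloisRestrict ℚ K a) • (P : W.geomPoints)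
    rw [mul_smul, mul_smul]
    exact smul_comm_of_comm W p hμμ hm hne hM (hcomm _ (hfix a)) (hcomm _ (hfix b)) P P.2
  rw [mul_smul, ← RatClosure.torsionEquiv_smul, map_mul, hcommP, ← map_mul,
    RatClosure.torsionEquiv_smul, inv_smul_smul]

end Leaf

end Summit.BirchSwinnertonDyer.BirchSwinnertonDyer.Theorems.PrintCFram.BorelHomothety

end
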